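import Mathlib.RepresentationTheory.Basic
import Mathlib.Tactic.Module
import HarnessLib

/-!
# Route `EisensteinPrimes`, line `mudescent`, cruxes 3/5: the KUMMER PLANE LEMMA — the Galois-module
# algebra behind the relative analytic λ-count on type-A rows (helper; pure algebra, THEOREMS ONLY)

Seat `bsd-eis-lam-a` g8 (PROGRAMME PART 1b, ACCEL-LIST (4): ANALYTIC side of
`stub_lambdaCount_offLocus`; items stmt-BirchSwinnertonDyer-19033 / -19035; skeleton owner bsd-eis-ky,
`Lines/mudescent.lean`; research object (C-λ) = aside stmt-BirchSwinnertonDyer-20112). No definition, no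
named fact, nothing about any particular curve; closes nothing; moves no label.

WHAT AND WHY (HOME/lam-a-g8/lam-a-MEMO-8.md, THEOREM A). For type-A Eisenstein twins (elliptic curves
`E, E′` over `ℚ` with a rational `p`-torsion point and `E[p] ≅ E′[p]` a NON-split extension of `μ_p` by
`ℤ/p`) the relative count «`μ = 0` transfers and `λ + Σδ` agree» (Greenberg–Vatsal (1.4)/(3.9)-type; the
cell's (C-λ)) is, at a common squarefree level `M` in the generic Atkin–Lehner sign case, a statement
about planes in `U ⊂ J₀(M)[p]`: every member contributes the plane `W_E =` image of `E[p]`, all planes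
contain the same rational cuspidal line `ℓ₀ = ⟨e₀⟩` (Ohta 2014 Thm. (3.6.2): `J₀(M)(ℚ)[p^∞]^ε` is
cyclic), `U/ℓ₀` is `ω`-isotypic (`ω` = mod-`p` cyclotomic character), and `U` contains NO Galois-stable
line on which `G_ℚ` acts by `ω` (such a line is a `μ_p ⊂ J₀(M)`, hence inside the Shimura subgroup by
Vatsal, JIMJ 4 (2005) Thm. 1.1, whose `ε`-part vanishes in the generic sign case). The member's mod-`p`
plus modular symbol is the Weil dual of the `(−1)`-eigenvector `w_E ∈ W_E` of complex conjugation, and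
`g·w_E = ω(g)w_E + c_E(g)e₀` with `c_E` a cocycle representing the Kummer class of `E[p]`. THIS FILE
proves the algebra turning these facts into the conclusion, for ANY group `G`, field `k`, character
`ω : G →* kˣ`, representation `ρ : G →* (V →ₗ[k] V)` and vector `e₀`. CONVENTIONS (hypotheses are
spelled out in every statement, no `Prop` definitions): «no `ω`-line» is
`hno : ∀ v, (∀ g, ρ g v = ω(g) • v) → v = 0`; «`w` is a Kummer vector with cocycle `c : G → k`» is
`∀ g, ρ g w = ω(g) • w + c g • e₀`.

* §1 `kummerVector_eq_of_cocycle_rel`: no `ω`-line, `e₀` fixed, `w₁, w₂, w₃` Kummer vectors whose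
  cocycles satisfy `c₃ = a·c₁ + b·c₂ + (ω − 1)·m` pointwise (a relation of classes in `H¹(G, k(ω⁻¹))`
  written on cocycles; `cocycle_mul`, `kummerVector_sub_smul` record that these ARE cocycles and that
  `(ω − 1)·m` ARE the coboundaries) ⟹ `w₃ = a·w₁ + b·w₂ − m·e₀`: positions are LINEAR in the class;
  `kummerVector_eq_of_coboundary`: a coboundary class forces `w ∈ k·e₀` (injectivity).
* §2 with an element `σ ∈ G` fixing `e₀` and negating the `wᵢ` (complex conjugation; `2 ≠ 0` in `k`):
  `kummerVector_eq_of_cocycle_rel_of_neg` gives `w₃ = a·w₁ + b·w₂` on the nose — the mod-`p` plus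
  modular symbols of type-A members at a common level satisfy exactly the linear relations of their
  Kummer classes (the cell's (C-Θ-coh), MEMO-7 §2b) —, `kummerVector_eq_smul_of_twin` gives `w₂ = u·w₁`
  for twins (ONE unit `u`: (C-sym) ⟹ (C-λ)), `kummerVector_eq_zero_of_coboundary` gives `w = 0` for a
  trivial class.

HONEST FRAMING. The instantiation (`V = U ⊂ J₀(M)[p]`, `e₀` a generator of `C(M)[p]^ε`, absence of
`ω`-lines from Vatsal's theorem and the sign computation, plus symbols = Weil duals) lives in MEMO-8
and is NOT asserted here: the tree has no `J₀(N)` / Shimura-subgroup vocabulary. The lemma is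
displayed so that a future typed statement can consume it verbatim.

References: [Vatsal2005] Thm. 1.1; [Ohta2014] Thm. (3.6.2); [GreenbergVatsal2000] (1.4), §3;
HOME/lam-a-g8/lam-a-MEMO-8.md §§1–3; HOME/lam-a-g7/lam-a-MEMO-7.md §2b.
-/

set_option linter.dupNamespace false
set_option autoImplicit false

namespace Summit.BirchSwinnertonDyer.BirchSwinnertonDyer.Theorems.EisensteinPrimesKummerPlaneLemma

variable {k : Type*} [Field k] {G : Type*} [Group G] {V : Type*} [AddCommGroup V] [Module k V]
variable {ρ : Representation k G V} {ω : G →* kˣ} {e₀ : V}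

/-! ## §1. Positions are linear in the cocycle class -/

/-- **Kummer plane lemma (linearity).** If `V` has no `ω`-line, `e₀` is `G`-fixed, and `w₁, w₂, w₃` are
Kummer vectors with cocycles satisfying `c₃ = a·c₁ + b·c₂ + (ω − 1)·m` pointwise (i.e. the classes
satisfy `[c₃] = a[c₁] + b[c₂]` in `H¹(G, k(ω⁻¹))`, the difference being the coboundary of `m`), then
`w₃ = a·w₁ + b·w₂ − m·e₀`. Proof: `v := w₃ − a·w₁ − b·w₂ + m·e₀` satisfies `ρ g v = ω(g)·v`. [folklore] -/
theorem kummerVector_eq_of_cocycle_rel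
    (hno : ∀ v : V, (∀ g : G, ρ g v = ((ω g : kˣ) : k) • v) → v = 0)
    (he₀ : ∀ g : G, ρ g e₀ = e₀) {w₁ w₂ w₃ : V} {c₁ c₂ c₃ : G → k}
    (h₁ : ∀ g : G, ρ g w₁ = ((ω g : kˣ) : k) • w₁ + c₁ g • e₀)
    (h₂ : ∀ g : G, ρ g w₂ = ((ω g : kˣ) : k) • w₂ + c₂ g • e₀)
    (h₃ : ∀ g : G, ρ g w₃ = ((ω g : kˣ) : k) • w₃ + c₃ g • e₀) {a b m : k}
    (hrel : ∀ g : G, c₃ g = a * c₁ g + b * c₂ g + (((ω g : kˣ) : k) - 1) * m) :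
    w₃ = a • w₁ + b • w₂ - m • e₀ := by
  set v : V := w₃ - a • w₁ - b • w₂ + m • e₀ with hv
  have hGv : ∀ g : G, ρ g v = ((ω g : kˣ) : k) • v := by
    intro g
    have e1 := h₁ g
    have e2 := h₂ g
    have e3 := h₃ g
    have e4 := he₀ g
    have e5 := hrel g
    simp only [hv, map_add, map_sub, map_smul, e1, e2, e3, e4, e5]
    module
  have hv0 : v = 0 := hno v hGv
  rw [hv] at hv0
  have : w₃ = (w₃ - a • w₁ - b • w₂ + m • e₀) + (a • w₁ + b • w₂ - m • e₀) := by module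
  rw [this, hv0, zero_add]

/-- **Injectivity of the class map.** If `V` has no `ω`-line, `e₀` is `G`-fixed and `w` is a Kummer
vector whose cocycle is a coboundary, `c = (ω − 1)·m`, then `w = −m·e₀ ∈ k·e₀` (the plane degenerates
to the line): a position outside `k·e₀` has a nonzero Kummer class. [folklore] -/
theorem kummerVector_eq_of_coboundary
    (hno : ∀ v : V, (∀ g : G, ρ g v = ((ω g : kˣ) : k) • v) → v = 0)
    (he₀ : ∀ g : G, ρ g e₀ = e₀) {w : V} {c : G → k}
    (h : ∀ g : G, ρ g w = ((ω g : kˣ) : k) • w + c g • e₀) {m : k}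
    (hcob : ∀ g : G, c g = (((ω g : kˣ) : k) - 1) * m) : w = -(m • e₀) := by
  have h0 : ∀ g : G, ρ g (0 : V) = ((ω g : kˣ) : k) • (0 : V) + (fun _ : G => (0 : k)) g • e₀ := by
    intro g; simp
  have hrel : ∀ g : G, c g = (0 : k) * (fun _ : G => (0 : k)) g + 0 * (fun _ : G => (0 : k)) g +
      (((ω g : kˣ) : k) - 1) * m := by
    intro g; simp [hcob g]
  have := kummerVector_eq_of_cocycle_rel hno he₀ h0 h0 h (a := 0) (b := 0) (m := m) hrel
  simpa using this

/-- A Kummer vector with coboundary cocycle lies in the line `k·e₀`. [folklore] -/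
theorem kummerVector_mem_span_of_coboundary
    (hno : ∀ v : V, (∀ g : G, ρ g v = ((ω g : kˣ) : k) • v) → v = 0)
    (he₀ : ∀ g : G, ρ g e₀ = e₀) {w : V} {c : G → k}
    (h : ∀ g : G, ρ g w = ((ω g : kˣ) : k) • w + c g • e₀) {m : k}
    (hcob : ∀ g : G, c g = (((ω g : kˣ) : k) - 1) * m) : w ∈ Submodule.span k {e₀} := by
  rw [kummerVector_eq_of_coboundary hno he₀ h hcob]
  exact Submodule.neg_mem _ (Submodule.smul_mem _ _ (Submodule.subset_span rfl))

/-- **Twins, general form.** Cocycles agreeing up to a unit and a coboundary, `c₂ = u·c₁ + (ω − 1)·m`,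
give `w₂ = u·w₁ − m·e₀`. [folklore] -/
theorem kummerVector_eq_of_twin
    (hno : ∀ v : V, (∀ g : G, ρ g v = ((ω g : kˣ) : k) • v) → v = 0)
    (he₀ : ∀ g : G, ρ g e₀ = e₀) {w₁ w₂ : V} {c₁ c₂ : G → k}
    (h₁ : ∀ g : G, ρ g w₁ = ((ω g : kˣ) : k) • w₁ + c₁ g • e₀)
    (h₂ : ∀ g : G, ρ g w₂ = ((ω g : kˣ) : k) • w₂ + c₂ g • e₀) {u m : k}
    (hrel : ∀ g : G, c₂ g = u * c₁ g + (((ω g : kˣ) : k) - 1) * m) :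
    w₂ = u • w₁ - m • e₀ := by
  have h0 : ∀ g : G, ρ g (0 : V) = ((ω g : kˣ) : k) • (0 : V) + (fun _ : G => (0 : k)) g • e₀ := by
    intro g; simp
  have hrel' : ∀ g : G, c₂ g = u * c₁ g + 0 * (fun _ : G => (0 : k)) g +
      (((ω g : kˣ) : k) - 1) * m := by
    intro g; simp [hrel g]
  have := kummerVector_eq_of_cocycle_rel hno he₀ h₁ h0 h₂ (a := u) (b := 0) (m := m) hrel'
  simpa using this

/-- **Cocycle identity.** The "cocycle" of a Kummer vector satisfies `c(gg′) = c(g′) + ω(g′)·c(g)`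
(equivalently `g ↦ ω(g)⁻¹c(g)` is a `1`-cocycle with values in `k(ω⁻¹)`), provided `e₀ ≠ 0` is
`G`-fixed — so the relation `hrel` of `kummerVector_eq_of_cocycle_rel` is a statement about classes in
`H¹(G, k(ω⁻¹))`. [folklore] -/
theorem cocycle_mul (he : e₀ ≠ 0) (he₀ : ∀ g : G, ρ g e₀ = e₀) {w : V} {c : G → k}
    (h : ∀ g : G, ρ g w = ((ω g : kˣ) : k) • w + c g • e₀) (g g' : G) :
    c (g * g') = c g' + ((ω g' : kˣ) : k) * c g := by
  have e2 : ρ (g * g') w = ρ g (ρ g' w) := by rw [map_mul]; rfl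
  rw [h (g * g'), h g', map_add, map_smul, map_smul, h g, he₀ g, map_mul, Units.val_mul] at e2
  have e3 : (c (g * g') - (c g' + ((ω g' : kˣ) : k) * c g)) • e₀ = 0 := by
    have : (c (g * g') - (c g' + ((ω g' : kˣ) : k) * c g)) • e₀
        = ((((ω g : kˣ) : k) * ((ω g' : kˣ) : k)) • w + c (g * g') • e₀)
          - (((ω g' : kˣ) : k) • ((((ω g : kˣ) : k)) • w + c g • e₀) + c g' • e₀) := by
      module
    rw [this, e2, sub_self]
  rcases smul_eq_zero.mp e3 with h1 | h1
  · exact sub_eq_zero.mp h1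
  · exact absurd h1 he

/-- **Coboundaries.** Changing the Kummer vector inside its plane, `w ↦ w − m·e₀`, changes the cocycle
by the coboundary `(ω − 1)·m` (so the `m`-terms in `hrel` are exactly the ambiguity of the lift).
[folklore] -/
theorem kummerVector_sub_smul (he₀ : ∀ g : G, ρ g e₀ = e₀) {w : V} {c : G → k}
    (h : ∀ g : G, ρ g w = ((ω g : kˣ) : k) • w + c g • e₀) (m : k) (g : G) :
    ρ g (w - m • e₀) = ((ω g : kˣ) : k) • (w - m • e₀) + (c g + (((ω g : kˣ) : k) - 1) * m) • e₀ := by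
  rw [map_sub, map_smul, h g, he₀ g]
  module

/-- **Uniqueness of the cocycle.** If `e₀ ≠ 0`, the cocycle of a Kummer vector is determined by the
vector. [folklore] -/
theorem cocycle_unique (he : e₀ ≠ 0) {w : V} {c c' : G → k}
    (h : ∀ g : G, ρ g w = ((ω g : kˣ) : k) • w + c g • e₀)
    (h' : ∀ g : G, ρ g w = ((ω g : kˣ) : k) • w + c' g • e₀) : c = c' := by
  funext g
  have hh := (h g).symm.trans (h' g)
  have h0 : (c g - c' g) • e₀ = 0 := by
    rw [sub_smul]; exact sub_eq_zero.mpr (add_left_cancel hh)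
  rcases smul_eq_zero.mp h0 with h1 | h1
  · exact sub_eq_zero.mp h1
  · exact absurd h1 he

/-! ## §2. With complex conjugation: exact linearity on the minus eigenspace -/

/-- If `σ` fixes `e₀` and negates both `x` and `y`, and `x = y − m·e₀`, then `x = y` provided `2 ≠ 0`
in `k` (the `e₀`-component of a `(−1)`-eigenvector vanishes). [folklore] -/
theorem eq_of_sub_smul_fixed_of_neg {σ : G} (he₀σ : ρ σ e₀ = e₀) (h2 : (2 : k) ≠ 0) {x y : V}
    (hx : ρ σ x = -x) (hy : ρ σ y = -y) {m : k} (hxy : x = y - m • e₀) : x = y := by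
  have h' : ρ σ x = ρ σ (y - m • e₀) := by rw [hxy]
  rw [map_sub, map_smul, hx, hy, he₀σ, hxy] at h'
  -- h' : -(y - m • e₀) = -y - m • e₀
  have h2m : (2 : k) • (m • e₀) = 0 := by
    have : (2 : k) • (m • e₀) = (-(y - m • e₀)) - (-y - m • e₀) := by module
    rw [this, h', sub_self]
  have hm0 : m • e₀ = 0 := by
    rcases smul_eq_zero.mp h2m with h | h
    · exact absurd h h2
    · exact h
  rw [hxy, hm0, sub_zero]

/-- **Kummer plane lemma on the minus part.** In the situation of `kummerVector_eq_of_cocycle_rel`,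
if moreover `σ ∈ G` (complex conjugation) fixes `e₀` and negates `w₁, w₂, w₃`, and `2 ≠ 0` in `k`, then
`w₃ = a·w₁ + b·w₂` exactly: the mod-`p` plus modular symbols of type-A members at a common level
satisfy precisely the linear relations of their Kummer classes (MEMO-8 THEOREM A (d); the cell's
(C-Θ-coh), verified at `N = 2562, 3090, 2730`, `p = 3` in MEMO-7 §2b). [folklore] -/
theorem kummerVector_eq_of_cocycle_rel_of_neg
    (hno : ∀ v : V, (∀ g : G, ρ g v = ((ω g : kˣ) : k) • v) → v = 0)
    (he₀ : ∀ g : G, ρ g e₀ = e₀) {σ : G} (h2 : (2 : k) ≠ 0) {w₁ w₂ w₃ : V}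
    (hσ₁ : ρ σ w₁ = -w₁) (hσ₂ : ρ σ w₂ = -w₂) (hσ₃ : ρ σ w₃ = -w₃) {c₁ c₂ c₃ : G → k}
    (h₁ : ∀ g : G, ρ g w₁ = ((ω g : kˣ) : k) • w₁ + c₁ g • e₀)
    (h₂ : ∀ g : G, ρ g w₂ = ((ω g : kˣ) : k) • w₂ + c₂ g • e₀)
    (h₃ : ∀ g : G, ρ g w₃ = ((ω g : kˣ) : k) • w₃ + c₃ g • e₀) {a b m : k}
    (hrel : ∀ g : G, c₃ g = a * c₁ g + b * c₂ g + (((ω g : kˣ) : k) - 1) * m) :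
    w₃ = a • w₁ + b • w₂ := by
  have h := kummerVector_eq_of_cocycle_rel hno he₀ h₁ h₂ h₃ hrel
  have hy : ρ σ (a • w₁ + b • w₂) = -(a • w₁ + b • w₂) := by
    rw [map_add, map_smul, map_smul, hσ₁, hσ₂]; module
  exact eq_of_sub_smul_fixed_of_neg (he₀ σ) h2 hσ₃ hy h

/-- **Twins.** If `V` has no `ω`-line, `e₀` is `G`-fixed, `σ` negates the Kummer vectors `w₁, w₂`
(`2 ≠ 0` in `k`), and their cocycles agree up to a unit and a coboundary (`E[p] ≅ E′[p]`:
`c₂ = u·c₁ + (ω − 1)·m`), then `w₂ = u·w₁`: twins have proportional mod-`p` plus modular symbols at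
the common level, with ONE unit `u` (MEMO-8 THEOREM A (d) ⟹ (C-sym) ⟹ (C-λ)). [folklore] -/
theorem kummerVector_eq_smul_of_twin
    (hno : ∀ v : V, (∀ g : G, ρ g v = ((ω g : kˣ) : k) • v) → v = 0)
    (he₀ : ∀ g : G, ρ g e₀ = e₀) {σ : G} (h2 : (2 : k) ≠ 0) {w₁ w₂ : V}
    (hσ₁ : ρ σ w₁ = -w₁) (hσ₂ : ρ σ w₂ = -w₂) {c₁ c₂ : G → k}
    (h₁ : ∀ g : G, ρ g w₁ = ((ω g : kˣ) : k) • w₁ + c₁ g • e₀)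
    (h₂ : ∀ g : G, ρ g w₂ = ((ω g : kˣ) : k) • w₂ + c₂ g • e₀) {u m : k}
    (hrel : ∀ g : G, c₂ g = u * c₁ g + (((ω g : kˣ) : k) - 1) * m) :
    w₂ = u • w₁ := by
  have h := kummerVector_eq_of_twin hno he₀ h₁ h₂ hrel
  have hy : ρ σ (u • w₁) = -(u • w₁) := by rw [map_smul, hσ₁, smul_neg]
  exact eq_of_sub_smul_fixed_of_neg (he₀ σ) h2 hσ₂ hy h

/-- **Trivial class ⟹ zero position.** A Kummer vector negated by `σ` whose cocycle is a coboundary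
vanishes (`2 ≠ 0` in `k`): on the minus part, the class map from positions to `H¹(G, k(ω⁻¹))` is
injective (MEMO-8 THEOREM A (c)). [folklore] -/
theorem kummerVector_eq_zero_of_coboundary
    (hno : ∀ v : V, (∀ g : G, ρ g v = ((ω g : kˣ) : k) • v) → v = 0)
    (he₀ : ∀ g : G, ρ g e₀ = e₀) {σ : G} (h2 : (2 : k) ≠ 0) {w : V} (hσ : ρ σ w = -w)
    {c : G → k} (h : ∀ g : G, ρ g w = ((ω g : kˣ) : k) • w + c g • e₀) {m : k}
    (hcob : ∀ g : G, c g = (((ω g : kˣ) : k) - 1) * m) : w = 0 := by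
  have hw : w = 0 - m • e₀ := by
    rw [kummerVector_eq_of_coboundary hno he₀ h hcob]; module
  have hy : ρ σ (0 : V) = -0 := by simp
  exact eq_of_sub_smul_fixed_of_neg (he₀ σ) h2 hσ hy hw

/-- **Dimension count (P-mult1).** If `e₀ ≠ 0` and the cocycles of two Kummer vectors `w₁, w₂` are
linearly independent modulo coboundaries — every relation `a·c₁ + b·c₂ = (ω − 1)·m` has `a = b = 0` —
then `w₁, w₂` are linearly independent (no `ω`-line hypothesis needed for this direction): two
non-twin type-A members of one component give, with `e₀`, three independent vectors of `J₀(M)[𝔪^ε]`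
(MEMO-7 §4 «P-mult1» ⟸ MEMO-8 Cor. A3). [folklore] -/
theorem linearIndependent_of_classes (he : e₀ ≠ 0) {w₁ w₂ : V} {c₁ c₂ : G → k}
    (h₁ : ∀ g : G, ρ g w₁ = ((ω g : kˣ) : k) • w₁ + c₁ g • e₀)
    (h₂ : ∀ g : G, ρ g w₂ = ((ω g : kˣ) : k) • w₂ + c₂ g • e₀)
    (hind : ∀ a b m : k, (∀ g : G, a * c₁ g + b * c₂ g = (((ω g : kˣ) : k) - 1) * m) →
      a = 0 ∧ b = 0) :
    ∀ a b : k, a • w₁ + b • w₂ = 0 → a = 0 ∧ b = 0 := by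
  intro a b hab
  -- the vector a•w₁ + b•w₂ is a Kummer vector with cocycle a c₁ + b c₂; it is 0, so its cocycle is
  -- the cocycle of 0, i.e. identically 0 = (ω - 1)·0.
  have hK : ∀ g : G, ρ g (a • w₁ + b • w₂) =
      ((ω g : kˣ) : k) • (a • w₁ + b • w₂) + (a * c₁ g + b * c₂ g) • e₀ := by
    intro g
    rw [map_add, map_smul, map_smul, h₁ g, h₂ g]
    module
  have hzero : ∀ g : G, a * c₁ g + b * c₂ g = (((ω g : kˣ) : k) - 1) * 0 := by
    intro g
    have hg := hK g
    rw [hab, map_zero, smul_zero, zero_add] at hg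
    -- hg : 0 = (a * c₁ g + b * c₂ g) • e₀
    rcases smul_eq_zero.mp hg.symm with h1 | h1
    · rw [h1]; ring
    · exact absurd h1 he
  exact hind a b 0 hzero

end Summit.BirchSwinnertonDyer.BirchSwinnertonDyer.Theorems.EisensteinPrimesKummerPlaneLemma
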